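import Mathlib
import Literature.NumberTheory.LFunctions.WeilMarkovQuadratic
import Literature.NumberTheory.LFunctions.WeilLogLatticeComb
import Literature.NumberTheory.LFunctions.WeilArchimedeanMoments
import Summits.RiemannHypothesis.RiemannHypothesis.Theorems.PfPersistenceWindowCoercivity
import Summits.RiemannHypothesis.RiemannHypothesis.Theorems.PfPersistenceGalerkinIndexNumber
import Summits.RiemannHypothesis.RiemannHypothesis.Theorems.PfPersistenceTwoParityIndexFamilies
import HarnessLib

/-!
# GAL-7 — Fixed-window finiteness of the negative index; Galerkin saturation

Sub-problem `RiemannHypothesis`, cell `pub-rhpf` (Pf-persistence **mechanism / rigidity campaign; no RH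
claims**).  Third file of GAL-7: the kernel form of Yoshida's finiteness statement — *for a given window
`[-a, a]` the Weil form is positive definite on the finite-codimension subspace `K_N(a)` once `N` is
large* — proved here WITHOUT integration by parts on the Fourier transform, through the Weil–Markov
decomposition `Re Q(g) = P(g) + 𝓔_a(g) − M_a ‖g‖²` and the coercivity of the energy on high doubled-window
modes (files `PfPersistenceWindowIncrementParseval`, `PfPersistenceWindowCoercivity`).

Main results (all RH-free, no hypothesis on the number `K` of off-line zero quadruples):

* `realNegIndexAtLeast_le`: `RealNegIndexAtLeast n a → n ≤ 4 L(a) + 4` with the EXPLICIT level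
  `L(a) = windowLevel a = ⌈(2a/m) e^{max(M_a,0)}⌉`, `m = min(1, a/2)`; even and odd sectors follow
  (`evenNegIndexAtLeast_le`, `oddNegIndexAtLeast_le`);
* `evenNegIndex_lt_top`: the even negative index `ind⁻_ev(a)` of every window is finite;
* `galerkinNegIndex_le_windowBound`, `galerkinNegIndex_eventually_eq` (**Galerkin saturation**): the index
  numbers of the truncations `A^{(N)}(a)` are bounded by `4 L(a) + 4` and eventually constant in `N`
  (equal to `ind⁻_ev(a)`) — an `N`-ladder at a fixed window reveals finitely many negative directions;
* `tendsto_sInf_evenNegIndexAtLeast_atTop` (**thresholds do not accumulate**): if every level occurs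
  (e.g. `K = ∞`), the thresholds `aₙ = sInf {b | EvenNegIndexAtLeast n b}` tend to `+∞`;
* `weilPoleForm_add_le_re_weilQuadratic`, `re_weilQuadratic_pos_of_mem_windowSubspace` (Yoshida's
  Lemma 3 proper, complex tests): `Re Q − P` is COERCIVE on `{g : ĉ_k(g) = 0, |k| ≤ L(a)}` and `Re Q` is
  positive definite on `K_{L(a)}(a) = {ĉ_k(g) = 0 (|k| ≤ L(a)), ∫ g sinh(t/2) = 0}`, codimension `≤ 4L(a)+4`.

[cite: Yoshida1992, §1 p. 282 and Lemma 3] [cite: Bombieri2000Weil, Thm 2 (p. 193), Thm 8]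
-/

noncomputable section

open MeasureTheory Set Filter Topology
open scoped Real

set_option linter.dupNamespace false

namespace Summit.RiemannHypothesis.RiemannHypothesis.Theorems.PfPersistence

open Literature.NumberTheory.LFunctions

variable {a : ℝ}

section FiniteIndex

open Summit.RiemannHypothesis.RiemannHypothesis.Theorems.PfPersistenceM2NegIndex
open Summit.RiemannHypothesis.RiemannHypothesis.Theorems.PfPersistenceParityIndex (OddNegIndexAtLeast)

/-! ## The explicit level `L(a)` -/

/-- **The level of the window `[-a, a]`**: `L(a) = ⌈(2a/m) · e^{max(M_a, 0)}⌉`, `m = min(1, a/2)`,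
`M_a = weilMarkovConstant a`.  It is chosen so that `2 S(π (L(a)+1) m / 4a) > M_a`
(`weilMarkovConstant_lt_two_mul_sinSqLogInt`). [folklore] -/
def windowLevel (a : ℝ) : ℕ :=
  ⌈2 * a / min 1 (a / 2) * Real.exp (max (weilMarkovConstant a) 0)⌉₊

/-- The level beats the killing constant: `M_a < 2 S(π (L(a)+1) m / 4a)`. [folklore] -/
theorem weilMarkovConstant_lt_two_mul_sinSqLogInt (ha : 0 < a) :
    weilMarkovConstant a <
      2 * sinSqLogInt (π * ((windowLevel a : ℝ) + 1) * min 1 (a / 2) / (4 * a)) := by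
  set m : ℝ := min 1 (a / 2) with hm
  have hm0 : 0 < m := lt_min one_pos (by linarith)
  set M : ℝ := max (weilMarkovConstant a) 0 with hM
  have hM0 : 0 ≤ M := le_max_right _ _
  have hMa : weilMarkovConstant a ≤ M := le_max_left _ _
  have hL : 2 * a / m * Real.exp M < (windowLevel a : ℝ) + 1 := by
    have h := Nat.le_ceil (2 * a / m * Real.exp M)
    have : (windowLevel a : ℝ) = ⌈2 * a / m * Real.exp M⌉₊ := by rw [windowLevel]
    linarith
  have hL' : Real.exp M * (2 * a) < ((windowLevel a : ℝ) + 1) * m := by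
    have := mul_lt_mul_of_pos_right hL hm0
    rwa [div_mul_eq_mul_div, div_mul_cancel₀ _ hm0.ne', mul_comm] at this
  have hratio : Real.exp M < ((windowLevel a : ℝ) + 1) * m / (2 * a) := by
    rwa [lt_div_iff₀ (by positivity)]
  have hexp1 : 1 ≤ Real.exp M := Real.one_le_exp hM0
  set Y : ℝ := π * ((windowLevel a : ℝ) + 1) * m / (4 * a) with hY
  have hYeq : Y = π / 2 * (((windowLevel a : ℝ) + 1) * m / (2 * a)) := by
    rw [hY]
    field_simp
    ring
  have hY1 : π / 2 ≤ Y := by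
    rw [hYeq]
    have : 1 ≤ ((windowLevel a : ℝ) + 1) * m / (2 * a) := by linarith
    nlinarith [Real.pi_pos]
  have hY2 : π / 2 * Real.exp (2 * (M / 2)) < Y := by
    rw [hYeq, show 2 * (M / 2) = M by ring]
    exact mul_lt_mul_of_pos_left hratio (by positivity)
  have := lt_sinSqLogInt_of_lt hY1 hY2
  linarith

/-! ## Finiteness of the negative index at a fixed window -/

/-- **GAL-7 (abstract threshold form).**  If `M_a < 2 S(π (N+1) m / 4a)` (`m = min(1, a/2)`), then the
real Weil form on the window `[-a, a]` has negative index at most `4N + 4`: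
`RealNegIndexAtLeast n a → n ≤ 4N + 4`.  Proof: a negative-definite real family of more than `4N + 4`
tests has a non-trivial real combination `G` with `ĉ_k(G) = 0` for `|k| ≤ N` (`2(2N+1)` real
conditions) and `∫ G sinh(t/2) = 0` (`2` real conditions); then `P(G) ≥ 0`,
`𝓔_a(G) ≥ 2S ‖G‖²` (coercivity) and `Re Q(G) = P + 𝓔_a − M_a ‖G‖² ≥ 0`, contradicting negativity.
RH-free. [cite: Yoshida1992, §1 p. 282 and Lemma 3 (kernel form, Dirichlet-form proof)] -/
theorem realNegIndexAtLeast_le_of_lt_sinSqLogInt (ha : 0 < a) {N : ℕ}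
    (hN : weilMarkovConstant a < 2 * sinSqLogInt (π * (N + 1) * min 1 (a / 2) / (4 * a)))
    {n : ℕ} (h : RealNegIndexAtLeast n a) : n ≤ 4 * N + 4 := by
  classical
  obtain ⟨g, htest, -, hsupp, hneg⟩ := h
  by_contra hlt
  rw [not_le] at hlt
  -- the `4N + 4` real-linear conditions, indexed by `Lab`
  let Lab := (Fin (2 * N + 1) ⊕ Fin (2 * N + 1)) ⊕ (Unit ⊕ Unit)
  have hcard : Fintype.card Lab = 4 * N + 4 := by
    simp only [Lab, Fintype.card_sum, Fintype.card_fin, Fintype.card_unit]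
    ring
  let md : Fin (2 * N + 1) → ℤ := fun j ↦ (j : ℤ) - N
  let φ : Lab → Fin n → ℝ := fun l i ↦
    match l with
    | Sum.inl (Sum.inl j) => (winCoeff a (g i) (md j)).re
    | Sum.inl (Sum.inr j) => (winCoeff a (g i) (md j)).im
    | Sum.inr (Sum.inl _) => (∫ t : ℝ, g i t * (Real.sinh (t / 2) : ℂ)).re
    | Sum.inr (Sum.inr _) => (∫ t : ℝ, g i t * (Real.sinh (t / 2) : ℂ)).im
  let L : (Fin n → ℝ) →ₗ[ℝ] (Lab → ℝ) :=
    { toFun := fun c l ↦ ∑ i, c i * φ l i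
      map_add' := by
        intro c d
        funext l
        simp only [Pi.add_apply, add_mul, Finset.sum_add_distrib]
      map_smul' := by
        intro r c
        funext l
        simp only [Pi.smul_apply, smul_eq_mul, RingHom.id_apply, Finset.mul_sum, mul_assoc] }
  have hker : LinearMap.ker L ≠ ⊥ :=
    LinearMap.ker_ne_bot_of_finrank_lt
      (by simpa [Module.finrank_fintype_fun_eq_card, hcard] using hlt)
  obtain ⟨c, hc, hc0⟩ := Submodule.exists_mem_ne_zero_of_ne_bot hker
  have hL0 : ∀ l : Lab, ∑ i, c i * φ l i = 0 := fun l ↦ by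
    have := congrFun (LinearMap.mem_ker.1 hc) l
    simpa [L] using this
  -- the combination `G = Σ cᵢ gᵢ`
  set G : ℝ → ℂ := fun t ↦ ∑ i, (c i : ℂ) * g i t with hG
  have hgc : ∀ i, Continuous (g i) := fun i ↦ (htest i).1.continuous
  have hGtest : IsWeilTest G :=
    isWeilTest_finset_sum Finset.univ fun i _ ↦ (htest i).const_mul (c i)
  have hGsupp : Function.support G ⊆ Icc (-a) a := by
    intro t ht
    by_contra hnot
    apply ht
    show (∑ i, (c i : ℂ) * g i t) = 0
    refine Finset.sum_eq_zero fun i _ ↦ ?_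
    have hgi : g i t = 0 := by
      by_contra hne
      exact hnot (hsupp i (subset_tsupport _ hne))
    simp [hgi]
  have hGtsupp : tsupport G ⊆ Icc (-a) a := closure_minimal hGsupp isClosed_Icc
  -- the low modes of `G` vanish
  have hcoefG : ∀ k : ℤ, winCoeff a G k = ∑ i, (c i : ℂ) * winCoeff a (g i) k :=
    fun k ↦ winCoeff_sum_smul hgc c
  have hvan : ∀ k : ℤ, |k| ≤ N → winCoeff a G k = 0 := by
    intro k hk
    have hkN := abs_le.1 hk
    have hj : (k + N).toNat < 2 * N + 1 := by omega
    have hmd : md ⟨(k + N).toNat, hj⟩ = k := by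
      simp only [md]
      omega
    have hre := hL0 (Sum.inl (Sum.inl ⟨(k + N).toNat, hj⟩))
    have him := hL0 (Sum.inl (Sum.inr ⟨(k + N).toNat, hj⟩))
    simp only [φ, hmd] at hre him
    rw [hcoefG]
    apply Complex.ext
    · rw [Complex.re_sum]
      simpa [Complex.mul_re] using hre
    · rw [Complex.im_sum]
      simpa [Complex.mul_im] using him
  -- the `sinh`-moment of `G` vanishes, so the pole form is `≥ 0`
  have hsinh : ∫ t : ℝ, G t * (Real.sinh (t / 2) : ℂ) = 0 := by
    have hint : ∀ i, Integrable fun t : ℝ ↦ g i t * (Real.sinh (t / 2) : ℂ) :=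
      fun i ↦ (htest i).integrable_mul (by fun_prop)
    have hsum : ∫ t : ℝ, G t * (Real.sinh (t / 2) : ℂ) =
        ∑ i, (c i : ℂ) * ∫ t : ℝ, g i t * (Real.sinh (t / 2) : ℂ) := by
      have hpt : ∀ t : ℝ, G t * (Real.sinh (t / 2) : ℂ) =
          ∑ i, (c i : ℂ) * (g i t * (Real.sinh (t / 2) : ℂ)) := fun t ↦ by
        simp only [hG, Finset.sum_mul, mul_assoc]
      simp_rw [hpt]
      rw [integral_finsetSum _ fun i _ ↦ (hint i).const_mul _]
      simp only [integral_const_mul]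
    rw [hsum]
    have h1 := hL0 (Sum.inr (Sum.inl ()))
    have h2 := hL0 (Sum.inr (Sum.inr ()))
    simp only [φ] at h1 h2
    apply Complex.ext
    · rw [Complex.re_sum]
      simpa [Complex.mul_re] using h1
    · rw [Complex.im_sum]
      simpa [Complex.mul_im] using h2
  have hP : 0 ≤ weilPoleForm G := by
    unfold weilPoleForm
    rw [hsinh, norm_zero, zero_pow two_ne_zero, mul_zero, sub_zero]
    positivity
  -- coercivity of the energy and the Markov identity
  have hE := weilDirichletEnergy_ge_of_winCoeff_eq_zero ha hGtest hGsupp hvan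
  have hQ := weilQuadratic_re_eq_weilPoleForm_add_weilDirichletEnergy_sub hGtest hGtsupp
  have hnorm : 0 ≤ ∫ x, ‖G x‖ ^ 2 := integral_nonneg fun _ ↦ by positivity
  have hprod := mul_nonneg (sub_nonneg.2 hN.le) hnorm
  have hlt0 := hneg c hc0
  nlinarith [hE, hQ, hP, hprod, hlt0]

/-- **GAL-7 — FIXED-WINDOW FINITENESS (real sector).**  For every window `[-a, a]`, `a > 0`, the full
real Weil form has FINITE negative index: `RealNegIndexAtLeast n a → n ≤ 4 L(a) + 4` with the explicit
level `L(a) = windowLevel a`.  RH-free, and free of any hypothesis on the number `K = #𝒬` of off-line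
zero quadruples (in particular valid when `K = ∞`).  [cite: Yoshida1992, §1 p. 282 ("for a given
`a`, the form on `K_N(a)` is positive definite if `N` is sufficiently large") and Lemma 3] -/
theorem realNegIndexAtLeast_le (ha : 0 < a) {n : ℕ} (h : RealNegIndexAtLeast n a) :
    n ≤ 4 * windowLevel a + 4 :=
  realNegIndexAtLeast_le_of_lt_sinSqLogInt ha
    (by exact_mod_cast weilMarkovConstant_lt_two_mul_sinSqLogInt ha) h

/-- **GAL-7, even sector.** `EvenNegIndexAtLeast n a → n ≤ 4 L(a) + 4`. RH-free.
[cite: Yoshida1992, Lemma 3] -/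
theorem evenNegIndexAtLeast_le (ha : 0 < a) {n : ℕ} (h : EvenNegIndexAtLeast n a) :
    n ≤ 4 * windowLevel a + 4 :=
  realNegIndexAtLeast_le ha h.toReal

/-- **GAL-7, odd sector.** `OddNegIndexAtLeast n a → n ≤ 4 L(a) + 4`. RH-free.
[cite: Yoshida1992, Lemma 3] -/
theorem oddNegIndexAtLeast_le (ha : 0 < a) {n : ℕ} (h : OddNegIndexAtLeast n a) :
    n ≤ 4 * windowLevel a + 4 :=
  realNegIndexAtLeast_le ha h.toReal

/-- No window carries every level: `¬ RealNegIndexAtLeast (4 L(a) + 5) a`. RH-free. [folklore] -/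
theorem not_realNegIndexAtLeast_windowBound (ha : 0 < a) :
    ¬ RealNegIndexAtLeast (4 * windowLevel a + 5) a :=
  fun h ↦ absurd (realNegIndexAtLeast_le ha h) (by omega)

/-- No window carries every even level: `¬ EvenNegIndexAtLeast (4 L(a) + 5) a`. RH-free. [folklore] -/
theorem not_evenNegIndexAtLeast_windowBound (ha : 0 < a) :
    ¬ EvenNegIndexAtLeast (4 * windowLevel a + 5) a :=
  fun h ↦ absurd (evenNegIndexAtLeast_le ha h) (by omega)

/-- **The even negative index of a fixed window is finite**:
`ind⁻_ev(a) = ⨆ {n | EvenNegIndexAtLeast n a} ≤ 4 L(a) + 4 < ⊤`. RH-free. [folklore] -/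
theorem evenNegIndex_le_windowBound (ha : 0 < a) :
    (⨆ n : ℕ, ⨆ _ : EvenNegIndexAtLeast n a, (n : ℕ∞)) ≤ (4 * windowLevel a + 4 : ℕ) :=
  iSup_le fun _ ↦ iSup_le fun hn ↦ by exact_mod_cast evenNegIndexAtLeast_le ha hn

/-- `ind⁻_ev(a) < ⊤` at every window. RH-free. [folklore] -/
theorem evenNegIndex_lt_top (ha : 0 < a) :
    (⨆ n : ℕ, ⨆ _ : EvenNegIndexAtLeast n a, (n : ℕ∞)) < ⊤ :=
  (evenNegIndex_le_windowBound ha).trans_lt (ENat.coe_lt_top _)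

/-! ## Galerkin saturation at a fixed window -/

/-- **GALERKIN SATURATION.**  At a fixed window the negative index numbers of ALL truncations
`A^{(N)}(a)` of `ζ`'s window matrices are bounded by the window constant:
`ind⁻(A^{(N)}(a)) ≤ 4 L(a) + 4` for every `N`.  An `N`-ladder at fixed `a` can reveal only finitely many
negative directions, whatever the zeros do.  RH-free. [folklore] -/
theorem galerkinNegIndex_le_windowBound (ha : 0 < a) (N : ℕ) :
    galerkinNegIndex zetaDatum ⟨a, N, ha⟩ ≤ (4 * windowLevel a + 4 : ℕ) :=
  le_trans (le_iSup (fun N : ℕ ↦ galerkinNegIndex zetaDatum ⟨a, N, ha⟩) N)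
    ((iSup_galerkinNegIndex_eq_evenNegIndex ha).le.trans (evenNegIndex_le_windowBound ha))

/-- **Eventual constancy in `N`.**  The index numbers `ind⁻(A^{(N)}(a))`, non-decreasing in `N` and
bounded, are eventually equal to their supremum `ind⁻_ev(a)`: `∃ N₀, ∀ N ≥ N₀, ind⁻(A^{(N)}(a)) = ind⁻_ev(a)`.
RH-free. [folklore] -/
theorem galerkinNegIndex_eventually_eq (ha : 0 < a) :
    ∃ N₀ : ℕ, ∀ N, N₀ ≤ N →
      galerkinNegIndex zetaDatum ⟨a, N, ha⟩ = ⨆ n : ℕ, ⨆ _ : EvenNegIndexAtLeast n a, (n : ℕ∞) := by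
  set s : ℕ∞ := ⨆ n : ℕ, ⨆ _ : EvenNegIndexAtLeast n a, (n : ℕ∞) with hs
  have hfin : s < ⊤ := evenNegIndex_lt_top ha
  have hsup : (⨆ N : ℕ, galerkinNegIndex zetaDatum ⟨a, N, ha⟩) = s :=
    iSup_galerkinNegIndex_eq_evenNegIndex ha
  -- `s` is a natural number and the supremum of naturals-valued terms is attained
  obtain ⟨k, hk⟩ : ∃ k : ℕ, s = k := ⟨s.toNat, (ENat.coe_toNat hfin.ne).symm⟩
  have hle : ∀ N, galerkinNegIndex zetaDatum ⟨a, N, ha⟩ ≤ s := fun N ↦ by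
    rw [← hsup]
    exact le_iSup (fun N : ℕ ↦ galerkinNegIndex zetaDatum ⟨a, N, ha⟩) N
  by_cases hk0 : k = 0
  · refine ⟨0, fun N _ ↦ le_antisymm (hle N) ?_⟩
    rw [hk, hk0]
    exact bot_le
  · -- some truncation reaches level `k`
    have hlt : ((k - 1 : ℕ) : ℕ∞) < ⨆ N : ℕ, galerkinNegIndex zetaDatum ⟨a, N, ha⟩ := by
      rw [hsup, hk]
      exact_mod_cast Nat.sub_one_lt hk0
    obtain ⟨N₀, hN₀⟩ := lt_iSup_iff.1 hlt
    refine ⟨N₀, fun N hN ↦ le_antisymm (hle N) ?_⟩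
    have h1 : ((k - 1 : ℕ) : ℕ∞) < galerkinNegIndex zetaDatum ⟨a, N, ha⟩ :=
      hN₀.trans_le (zeta_galerkinNegIndex_mono hN)
    rw [hk]
    have h2 : ((k - 1 : ℕ) : ℕ∞) + 1 ≤ galerkinNegIndex zetaDatum ⟨a, N, ha⟩ := Order.add_one_le_of_lt h1
    have hk1 : ((k - 1 : ℕ) : ℕ∞) + 1 = k := by
      norm_cast
      omega
    rwa [hk1] at h2

/-! ## Thresholds do not accumulate -/

/-- **THRESHOLDS DO NOT ACCUMULATE.**  If every even level occurs at some window (e.g. when `K = ∞`),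
then for every `a` all but finitely many levels need windows LONGER than `a`: levels `n > 4 L(a) + 4` are
absent from every window `[-b, b]` with `b ≤ a`.  (m2's thresholds `aₙ = sInf {b | EvenNegIndexAtLeast n b}`
therefore tend to `∞`.)  RH-free. [folklore] -/
theorem evenNegIndexAtLeast_absent_below (ha : 0 < a) {n : ℕ} (hn : 4 * windowLevel a + 4 < n) {b : ℝ}
    (hb : b ≤ a) : ¬ EvenNegIndexAtLeast n b :=
  fun h ↦ absurd (evenNegIndexAtLeast_le ha (h.mono hb)) (not_le.2 hn)

/-- The even thresholds exceed every window eventually: if level `n > 4 L(a) + 4` occurs at all, its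
threshold `sInf {b | EvenNegIndexAtLeast n b}` is `≥ a`. RH-free. [folklore] -/
theorem le_sInf_evenNegIndexAtLeast (ha : 0 < a) {n : ℕ} (hn : 4 * windowLevel a + 4 < n)
    (hex : ∃ b, EvenNegIndexAtLeast n b) :
    a ≤ sInf {b : ℝ | EvenNegIndexAtLeast n b} := by
  obtain ⟨b₀, hb₀⟩ := hex
  refine le_csInf ⟨b₀, hb₀⟩ fun b hb ↦ ?_
  by_contra hba
  exact evenNegIndexAtLeast_absent_below ha hn (not_le.1 hba).le hb

/-- **Thresholds tend to infinity.**  If every even level occurs (`∀ n, ∃ b, EvenNegIndexAtLeast n b`,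
e.g. `K = ∞`), the thresholds `aₙ = sInf {b | EvenNegIndexAtLeast n b}` tend to `+∞`. RH-free.
[folklore] -/
theorem tendsto_sInf_evenNegIndexAtLeast_atTop (hall : ∀ n : ℕ, ∃ b : ℝ, EvenNegIndexAtLeast n b) :
    Tendsto (fun n : ℕ ↦ sInf {b : ℝ | EvenNegIndexAtLeast n b}) atTop atTop := by
  refine tendsto_atTop_atTop.2 fun a ↦ ?_
  refine ⟨4 * windowLevel (max a 1) + 5, fun n hn ↦ ?_⟩
  have ha : 0 < max a 1 := lt_of_lt_of_le one_pos (le_max_right _ _)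
  exact (le_max_left a 1).trans
    (le_sInf_evenNegIndexAtLeast ha (by omega) (hall n))


/-! ## Yoshida's Lemma 3 in kernel form: coercivity on an explicit finite-codimension subspace -/

/-- **COERCIVITY ON `K_{L(a)}(a)` (Yoshida's Lemma 3, kernel form, complex tests).**  On the window
`[-a, a]` every Weil test `g` whose doubled-window coefficients `ĉ_k(g)` vanish for `|k| ≤ L(a)`
satisfies `P(g) + (2S − M_a)·‖g‖₂² ≤ Re Q(g)` with `2S − M_a > 0`
(`S = S(π (L(a)+1) m / 4a)`, `weilMarkovConstant_lt_two_mul_sinSqLogInt`): the Weil form minus its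
pole form is COERCIVE on a subspace of real codimension `≤ 2(2L(a)+1)`.  RH-free.
[cite: Yoshida1992, Lemma 3] -/
theorem weilPoleForm_add_le_re_weilQuadratic (ha : 0 < a) {g : ℝ → ℂ} (hg : IsWeilTest g)
    (hsupp : tsupport g ⊆ Icc (-a) a) (hvan : ∀ k : ℤ, |k| ≤ windowLevel a → winCoeff a g k = 0) :
    weilPoleForm g +
        (2 * sinSqLogInt (π * ((windowLevel a : ℝ) + 1) * min 1 (a / 2) / (4 * a)) -
          weilMarkovConstant a) * ∫ x, ‖g x‖ ^ 2 ≤ (weilQuadratic g).re := by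
  have hE := weilDirichletEnergy_ge_of_winCoeff_eq_zero ha hg
    ((subset_tsupport g).trans hsupp) hvan
  have hQ := weilQuadratic_re_eq_weilPoleForm_add_weilDirichletEnergy_sub hg hsupp
  nlinarith [hE, hQ]

/-- **POSITIVE DEFINITENESS ON `K_{L(a)}(a)`.**  If moreover `∫ g(t) sinh(t/2) dt = 0` (two further real
conditions) and `g ≠ 0`, then `Re Q(g) > 0`: the Weil form of the window `[-a, a]` is positive definite
on the explicit subspace `K_{L(a)}(a) = {g : ĉ_k(g) = 0 (|k| ≤ L(a)), ∫ g sinh(t/2) = 0}` of real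
codimension `≤ 4 L(a) + 4` — for EVERY `a > 0`, with no hypothesis on the zeros.  RH-free.
[cite: Yoshida1992, §1 p. 282 and Lemma 3] -/
theorem re_weilQuadratic_pos_of_mem_windowSubspace (ha : 0 < a) {g : ℝ → ℂ} (hg : IsWeilTest g)
    (hsupp : tsupport g ⊆ Icc (-a) a) (hvan : ∀ k : ℤ, |k| ≤ windowLevel a → winCoeff a g k = 0)
    (hsinh : ∫ t : ℝ, g t * (Real.sinh (t / 2) : ℂ) = 0) (hne : g ≠ 0) :
    0 < (weilQuadratic g).re := by
  have hco := weilPoleForm_add_le_re_weilQuadratic ha hg hsupp hvan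
  have hS := weilMarkovConstant_lt_two_mul_sinSqLogInt ha
  have hP : 0 ≤ weilPoleForm g := by
    unfold weilPoleForm
    rw [hsinh, norm_zero, zero_pow two_ne_zero, mul_zero, sub_zero]
    positivity
  obtain ⟨x, hx⟩ := Function.ne_iff.1 hne
  have hx' : ‖g x‖ ^ 2 ≠ 0 := by
    have : g x ≠ 0 := by simpa using hx
    positivity
  have hcs : HasCompactSupport fun x ↦ ‖g x‖ ^ 2 :=
    (hg.2.norm).comp_left (g := fun y : ℝ ↦ y ^ 2) (by norm_num)
  have hnorm : 0 < ∫ x, ‖g x‖ ^ 2 :=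
    Continuous.integral_pos_of_hasCompactSupport_nonneg_nonzero (x := x)
      ((hg.1.continuous.norm).pow 2) hcs (fun _ ↦ by positivity) hx'
  nlinarith [mul_pos (sub_pos.2 hS) hnorm]

end FiniteIndex

end Summit.RiemannHypothesis.RiemannHypothesis.Theorems.PfPersistence

end
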